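import Summits.AtomisticToContinuum.Crystallization.Theorems.FluxTubeKeplerFluxCellKeplerSingleScale
import Summits.AtomisticToContinuum.Crystallization.Theorems.ChessboardParticlePlanesPeriodicWindowsIffCrystallization

/-!
# F4 on-path lemma for the forward rung `VacancyBlindRung` (vacancy ladder over `FluxTubeKepler.FloorGivesLayered`)

`Crystallization → VacRung κ` for every `κ` (in particular `→ VacancyBlindRung = VacRung 0`): the landed
hull-criterion converse `ChessboardParticlePlanesPeriodicWindowsIffCrystallization.periodicWindows_of_crystallization`
gives periodic windows along every Lennard-Jones ground-state sequence outright, so every member of the family is a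
CONSEQUENCE of the sub-problem (the rung lies on the path floor → summit).  Also the dial monotonicity
`vacRung_mono`.  Self-contained copy (sub-namespace `OnPath`) of the definitions of `Lines/VacancyBlindRung.lean`;
the canonical `VacancyLadder.vacRung_of_crystallization` / `VacancyLadder.VacancyBlindRung_of_Crystallization` live
there with the same text.  No `sorry`.
-/

noncomputable section

namespace Summit.AtomisticToContinuum.Crystallization.Cruxes.FluxCellKepler.VacancyLadder.OnPath

open scoped BigOperators Classical
open Filter Topology
open Literature.MathematicalPhysics.StatisticalMechanics
open Summit.AtomisticToContinuum.Crystallization.Theorems.FluxCellKeplerSingleScale (LayeredGood)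

local notation "E3" => EuclideanSpace ℝ (Fin 3)

/-- FLOOR(P₀) (verbatim copy of `VacancyLadder.Floor` in `Lines/VacancyBlindRung.lean`). -/
def Floor (P₀ : PeriodicConfiguration 3) : Prop :=
  ∀ (N : ℕ) (x : Fin N → E3), IsGroundState lennardJones x →
    (N : ℝ) * P₀.energyPerParticle lennardJones ≤ interactionEnergy lennardJones x

/-- `κ`-good site (verbatim copy of `VacancyLadder.VacGood`). -/
def VacGood (κ R η : ℝ) {N : ℕ} (x : Fin N → E3) (i : Fin N) : Prop :=
  ∃ a : ℝ, 47 / 50 ≤ a ∧ a ≤ 1 ∧ ∃ (A : E3 →ₗᵢ[ℝ] E3) (s : ℤ → ℤ) (z : ℤ → ℝ), IsHaggSeq s ∧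
    (∀ m : ℤ, 39 / 50 * a ≤ z (m + 1) - z m ∧ z (m + 1) - z m ≤ 17 / 20 * a) ∧
    let S : Set E3 := {p | ∃ m k l : ℤ, p = A (((k : ℝ) • triangularVec₁ a) + ((l : ℝ) • triangularVec₂ a) +
      ((haggLabel s m : ℝ) • barlowOffset a) + (z m • layerNormal 1))}
    (∀ p ∈ S, ‖p‖ ≤ κ * R → ∃ j : Fin N, dist (x j - x i) p ≤ η) ∧
    (∀ j : Fin N, ‖x j - x i‖ ≤ R → ∃ p ∈ S, dist (x j - x i) p ≤ η)

/-- The `κ`-budget (verbatim copy of `VacancyLadder.VacBudget`). -/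
def VacBudget (κ : ℝ) (P₀ : PeriodicConfiguration 3) : Prop :=
  ∀ R η : ℝ, 0 < R → 0 < η → ∃ c : ℝ, 0 < c ∧
    ∀ (N : ℕ) (x : Fin N → E3), IsGroundState lennardJones x →
      c * (Nat.card {i : Fin N // ¬ VacGood κ R η x i} : ℝ) ≤
        interactionEnergy lennardJones x - (N : ℝ) * P₀.energyPerParticle lennardJones

/-- Periodic windows along `x` (verbatim copy of `VacancyLadder.HasPeriodicWindows`). -/
def HasPeriodicWindows (x : (N : ℕ) → (Fin N → E3)) : Prop :=
  ∃ P : PeriodicConfiguration 3, ∀ R ε : ℝ, 0 < ε → ∃ᶠ N in atTop, ∃ t : E3,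
    (∀ s ∈ P.points, ‖s‖ ≤ R → ∃ i : Fin N, dist (x N i + t) s ≤ ε) ∧
    (∀ i : Fin N, ‖x N i + t‖ ≤ R → ∃ s ∈ P.points, dist (x N i + t) s ≤ ε)

/-- The graded family (verbatim copy of `VacancyLadder.VacRung`). -/
def VacRung (κ : ℝ) : Prop :=
  ∀ P₀ : PeriodicConfiguration 3, Floor P₀ → VacBudget κ P₀ →
    ∀ x : (N : ℕ) → (Fin N → E3), (∀ N, IsGroundState lennardJones (x N)) → HasPeriodicWindows x

/-- The deciding rung (verbatim copy of `VacancyLadder.VacancyBlindRung`). -/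
def VacancyBlindRung : Prop := VacRung 0

/-- **F4 — ON-PATH**: the sub-problem implies every member of the family. -/
theorem vacRung_of_crystallization (κ : ℝ) (h : _root_.Crystallization) : VacRung κ :=
  fun _ _ _ x hx =>
    Theorems.ChessboardParticlePlanesPeriodicWindowsIffCrystallization.periodicWindows_of_crystallization h x hx

@[aesop safe apply]
theorem VacancyBlindRung_of_Crystallization (h : _root_.Crystallization) : VacancyBlindRung :=
  vacRung_of_crystallization 0 h

example : _root_.Crystallization → VacancyBlindRung := VacancyBlindRung_of_Crystallization

/-- Dial monotonicity (harder-to-easier = increasing `κ`). -/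
theorem vacRung_mono {κ κ' : ℝ} (hκ : κ ≤ κ') : VacRung κ → VacRung κ' := by
  intro H P₀ hF hB x hx
  refine H P₀ hF ?_ x hx
  intro R η hR hη
  obtain ⟨c, hc, hcB⟩ := hB R η hR hη
  refine ⟨c, hc, fun N y hy => le_trans ?_ (hcB N y hy)⟩
  have hle : Nat.card {i : Fin N // ¬ VacGood κ R η y i} ≤ Nat.card {i : Fin N // ¬ VacGood κ' R η y i} := by
    rw [Nat.card_eq_fintype_card, Nat.card_eq_fintype_card]
    refine Fintype.card_subtype_mono _ _ fun i hi hg => hi ?_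
    obtain ⟨a, ha₁, ha₂, A, s, z, hs, hz, h₁, h₂⟩ := hg
    refine ⟨a, ha₁, ha₂, A, s, z, hs, hz, ?_, h₂⟩
    intro p hp hpR
    exact h₁ p hp (hpR.trans (mul_le_mul_of_nonneg_right hκ hR.le))
  exact mul_le_mul_of_nonneg_left (by exact_mod_cast hle) hc.le

end Summit.AtomisticToContinuum.Crystallization.Cruxes.FluxCellKepler.VacancyLadder.OnPath

end
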